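import Mathlib
import Summits.Ventures.HodgeRepro2.T6Composition
import Summits.Ventures.HodgeRepro2.T6InterfaceConj
import Summits.Ventures.HodgeRepro2.T6InterfaceToyN
import Summits.Ventures.HodgeRepro2.T6NAutToy

/-!
# T6NAutToyN — the toy `NAut` with a NON-DEGENERATE surface side: all six binders of the M2
composition jointly satisfied (README §10.5(ii)(d) for `periodInputN_of_mains`)

Cell pub-hodge-repro2, Tier 6 (README §10), seat t6-lead (gen 2). `T6NAutToy` (v1) discharged (c) and
the five AUTOMORPHIC binders of `periodInputN_of_mains` jointly, but not the N1 binder: its surface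
side was the degenerate toy shadow (`∫_S = 0`). This file swaps the surface side for the N-shadow of
`T6InterfaceToyN` (`ToyN.toyN F hw0`: `HS = HBC K`, `f^* = id`, `∫_S = ∫_B^ℂ (e_{sᶜ} ∪ ·)`, whose period
`I_σ = topCoeff(e_{sᶜ} · e_0 ∧ e_1 ∧ e_2 ∧ e_3) ≠ 0` by `ToyN.sN_spec`) and supplies the N1 datum's
complex conjugation on `HBC K` from `T6InterfaceConj` (`Conj.conjHBC`, antilinear involutive ring
endomorphism). The period datum `toyNDatumN F hw hw0`: choices = the N3 toy's Schwartz quadruples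
(as in v1), every choice admissible, every choice's shadow `toyN F hw0`, `τ₁ := σ`, generators
`e σ := eVec w` (the `σ`-eigenvectors `single i w`) and `0` at the other embeddings. The automorphic
side is v1's (`N3Toy.toy`, `NAutToy.toyNSide`, `N5Toy.toyData`).

RESULT. `toy_periodInputN_of_mains`: `periodInputN_of_mains` fires on the toy with EVERY binder
instantiated — N1 by `I_ne_zero` (the non-zero period), N3 by `toy_N3A` / `toy_N3iso`, N4 by
`toy_hypI`, N5 by `toyData_N5` — and `exists_joint`: for EVERY face setting `F` some period datum
and some carrier satisfy the six binders jointly (the eigenvector comes from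
`ToyN.exists_eigenvector_KC`). So the hypothesis set of the M2 composition is non-vacuous, and its
conclusion on the toy is the TRUE statement `Hyp.PeriodN (toyN F hw0)` (`ToyN.periodN_toyN`).

§8(d): uses an L-value-free non-vanishing device: NO.
-/

namespace Summit.Ventures.HodgeRepro2.T6.NAutToyN

open scoped InnerProductSpace

variable {K : Type} [Field K] [NumberField K]

/-- The generators: the `σ`-eigenvectors `single i w` at `σ`, `0` at every other embedding. -/
noncomputable def gen (σ : K →+* ℂ) (w : KC K) (σ' : K →+* ℂ) : Fin 4 → H1C K :=
  by classical exact if σ' = σ then ToyN.eVec w else 0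

/-- `gen` at `σ` is `eVec w`. -/
lemma gen_self (σ : K →+* ℂ) (w : KC K) : gen σ w σ = ToyN.eVec w := by
  unfold gen; simp

/-- `gen σ' i ∈ ℓ_{i,σ'}` for every embedding. -/
lemma gen_mem {σ : K →+* ℂ} {w : KC K} (hw : w ∈ eigenLineK K σ) (σ' : K →+* ℂ) (i : Fin 4) :
    gen σ w σ' i ∈ eigenLine K i σ' := by
  unfold gen
  split_ifs with h
  · subst h; exact ToyN.eVec_mem hw i
  · simp

section Datum

variable (F : FaceSetting K) {σ : K →+* ℂ} {w : KC K} (hw : w ∈ eigenLineK K σ) (hw0 : w ≠ 0)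

/-- The toy period datum with the non-degenerate surface side: choices = the N3 toy's Schwartz
quadruples, all admissible, shadow `ToyN.toyN F hw0`, base embedding `σ`, generators `gen`. -/
noncomputable def toyNDatumN : NDatum F where
  Choice := ℂ × ℂ × ℂ × ℂ
  AdmChoice _ := True
  shadow _ := ToyN.toyN F hw0
  τ₁ := σ
  e := gen σ w
  e_mem := gen_mem hw

/-- THE PERIOD IS NON-ZERO at every choice: `I_σ(D, c) = topCoeff(e_{sᶜ} · e_0 ∧ e_1 ∧ e_2 ∧ e_3) ≠ 0`
(`ToyN.sN_spec`). -/
theorem I_ne_zero (c : (toyNDatumN F hw hw0).Choice) : (toyNDatumN F hw hw0).I σ c ≠ 0 := by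
  show ToyN.intSN hw0 ((AlgHom.id ℂ (HBC K)) (ExteriorAlgebra.ι ℂ (gen σ w σ 0) *
    ExteriorAlgebra.ι ℂ (gen σ w σ 1) * ExteriorAlgebra.ι ℂ (gen σ w σ 2) *
    ExteriorAlgebra.ι ℂ (gen σ w σ 3))) ≠ 0
  rw [gen_self, AlgHom.id_apply, ToyN.intSN_apply, ToyN.extC_zN]
  exact ToyN.sN_spec hw0

/-- The N1 datum over the N3 toy's `L²([G]) = ℂ` on the non-degenerate surface side: conjugation =
`Conj.conjHBC` (coefficient conjugation on `H^*(B, ℂ)`), `H^{1,0} = ⊤`, the zero dictionary,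
`c_K = 1`. -/
noncomputable def toyN1N :
    N1Datum F (toyNDatumN F hw hw0) N3Toy.toy.LG
      (fun c => N3Toy.toy.A.F c.1 c.2.1) (fun c => N3Toy.toy.B.F c.2.2.1 c.2.2.2) where
  conj _ := Conj.conjHBC
  conj_smul _ z x := Conj.conjHBC_smul z x
  conj_conj _ x := Conj.conjHBC_conjHBC x
  H10 _ := ⊤
  sc _ := 0
  cK := 1
  cK_pos := one_pos

/-- THE TOY `NAut` over the non-degenerate period datum. -/
noncomputable def toy : NAut F (toyNDatumN F hw hw0) where
  d3 := N3Toy.toy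
  data c := c
  data_surj φa φb φc φd := ⟨(φa, φb, φc, φd), trivial, rfl⟩
  d1 := toyN1N F hw hw0
  sA := NAutToy.toyNSide
  sB := NAutToy.toyNSide
  ι5 := Unit
  G5 := Multiplicative ℤ
  d5 := N5Toy.toyData
  hypII_A_of_N5 _ := N3Toy.toy_hypII
  hypII_B_of_N5 _ := N3Toy.toy_hypII

/-- (d), ALL SIX BINDERS: `periodInputN_of_mains` fires on the toy with every binder instantiated. -/
theorem toy_periodInputN_of_mains :
    ∃ c, (toyNDatumN F hw hw0).AdmChoice c ∧ Hyp.PeriodN ((toyNDatumN F hw hw0).shadow c) :=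
  periodInputN_of_mains (toyNDatumN F hw hw0) (toy F hw hw0)
    (fun c _ _ => I_ne_zero F hw hw0 c)
    (fun _ _ => N3Toy.toy_N3A) (fun _ _ => N3Toy.toy_N3A)
    (fun _ _ => (toy F hw hw0).exists_choice_of_pairing_ne_zero N3Toy.toy_N3iso)
    ⟨N3Toy.toy_hypI, N3Toy.toy_hypI⟩ N5Toy.toyData_N5

end Datum

/-- NON-VACUITY OF THE M2 COMPOSITION'S HYPOTHESIS SET, UNCONDITIONAL IN THE FACE (README
§10.5(ii)(d)): for every face setting `F` there are a period datum `P` and a carrier `M` on which the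
six binders of `periodInputN_of_mains` hold jointly. -/
theorem exists_joint (F : FaceSetting K) :
    ∃ (P : NDatum F) (M : NAut F P),
      (∀ c, P.AdmChoice c → M.pairing c ≠ 0 → P.I P.τ₁ c ≠ 0) ∧
      (M.iA → M.iiA → M.ellA) ∧ (M.iB → M.iiB → M.ellB) ∧
      (M.ellA → M.ellB → ∃ c, P.AdmChoice c ∧ M.pairing c ≠ 0) ∧
      (M.iA ∧ M.iB) ∧ M.N5 := by
  obtain ⟨σ, w, hw, hw0⟩ := ToyN.exists_eigenvector_KC K
  exact ⟨toyNDatumN F hw hw0, toy F hw hw0, fun c _ _ => I_ne_zero F hw hw0 c,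
    fun _ _ => N3Toy.toy_N3A, fun _ _ => N3Toy.toy_N3A,
    fun _ _ => (toy F hw hw0).exists_choice_of_pairing_ne_zero N3Toy.toy_N3iso,
    ⟨N3Toy.toy_hypI, N3Toy.toy_hypI⟩, N5Toy.toyData_N5⟩

end Summit.Ventures.HodgeRepro2.T6.NAutToyN
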